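import Summits.CriticalPhenomena.CardyFormulaZ2.Theorems.CardyBoundaryCoulombGasHalfPlaneMarkDensityLawPosNearestLeftWindow

/-!
# `HalfPlaneMarkDensityLaw` (crux stmt-CriticalPhenomena-5661), line `Sketch`:
# stub `stub_nearRight_of_window2` — NearEndPos N1 (deterministic counting inclusion)

On the second-mark window event — some point of the stretch `[ℓ, m₂] × {0}` is joined inside the
lattice half-plane `H = ℤ × ℕ` to the arc `B = [lo, hi] × {0}` and no point of `[ℓ, m₁] × {0}` is —
let `k` be the LEAST abscissa in `[ℓ, m₂]` with `(k,0)` joined to `B` inside `H`.  Then `m₁ < k ≤ m₂`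
(abscissae in `[ℓ, m₁]` are excluded), `(k,0)` is joined inside `H` to some `(r,0)` with `lo ≤ r ≤ hi`,
and no `(s,0)` with `ℓ ≤ s < k` is joined to `(k,0)` inside `H`: otherwise `(s,0)` would be joined to
`B` through `(k,0)`, contradicting the minimality of `k`.  This is the mirror image of the cycle-4
stub `Positivity.stub_nearestLeft_of_window`, whose boundary-row bookkeeping
(`Positivity.bpt_mem_rowIcc_iff`, `Positivity.exists_eq_bpt_of_mem_rowIcc`) is reused.

* `stub_nearRight_of_window2`: `Int.exists_least_of_bdd`, with the tree's `openConnIn_comm` and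
  `PlanarDuality.openConnIn_trans` (`Literature…PlanarDuality`).
-/

noncomputable section

namespace Summit.CriticalPhenomena.CardyFormulaZ2.Cruxes.HalfPlaneMarkDensityLaw.SketchLine

open Literature.Probability.Percolation Literature.Probability.LatticeModels
open MeasureTheory Filter Set SimpleGraph
open scoped Topology
open Summit.CriticalPhenomena.CardyFormulaZ2.Theorems.HalfPlaneMarkDensityLaw.Negative

namespace NearEndPos

/-- STUB N1 (deterministic counting inclusion): on the second-mark window event (some point of `[ℓ,m₂]×{0}` joined inside `H` to `B = [lo,hi]×{0}`, none of `[ℓ,m₁]×{0}`), the leftmost joined point `k ∈ (m₁,m₂]` is joined to a point of `B` and to no point of `[ℓ,k)×{0}`. [folklore] -/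
theorem stub_nearRight_of_window2 :
    ∀ (ω : BondConfig (Site 2)) (ℓ m₁ m₂ lo hi : ℤ),
      ω ∈ openCrossing halfPlane (rowIcc ℓ m₂) (rowIcc lo hi) \ openCrossing halfPlane (rowIcc ℓ m₁) (rowIcc lo hi) →
      ∃ k : ℤ, m₁ < k ∧ k ≤ m₂ ∧
        ω ∈ {ω : BondConfig (Site 2) | (∃ r : ℤ, lo ≤ r ∧ r ≤ hi ∧ ω ∈ openConnIn halfPlane (bpt (k)) (bpt r)) ∧ ∀ s : ℤ, ℓ ≤ s → s < k → ω ∉ openConnIn halfPlane (bpt (k)) (bpt s)} := by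
  intro ω ℓ m₁ m₂ lo hi hω
  obtain ⟨hin, hout⟩ := hω
  obtain ⟨x, hx, y, hy, hxy⟩ := mem_openCrossing_iff.1 hin
  obtain ⟨j, rfl, hlj, hjm⟩ := Positivity.exists_eq_bpt_of_mem_rowIcc hx
  obtain ⟨i, rfl, hloi, hihi⟩ := Positivity.exists_eq_bpt_of_mem_rowIcc hy
  -- the least abscissa `k ∈ [ℓ, m₂]` with `(k,0)` joined inside `H` to `B`
  obtain ⟨k, ⟨hlk, hkm, r, hlor, hrhi, hkr⟩, hkmin⟩ := Int.exists_least_of_bdd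
    (P := fun k ↦ ℓ ≤ k ∧ k ≤ m₂ ∧
      ∃ r : ℤ, lo ≤ r ∧ r ≤ hi ∧ ω ∈ openConnIn halfPlane (bpt k) (bpt r))
    ⟨ℓ, fun z hz ↦ hz.1⟩ ⟨j, hlj, hjm, i, hloi, hihi, hxy⟩
  refine ⟨k, ?_, hkm, ⟨r, hlor, hrhi, hkr⟩, fun s hls hsk hks ↦ ?_⟩
  · -- `m₁ < k`: no point of `[ℓ, m₁] × {0}` is joined to `B`
    by_contra h
    exact hout (mem_openCrossing_iff.2
      ⟨bpt k, (Positivity.bpt_mem_rowIcc_iff k ℓ m₁).2 ⟨hlk, by omega⟩,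
        bpt r, (Positivity.bpt_mem_rowIcc_iff r lo hi).2 ⟨hlor, hrhi⟩, hkr⟩)
  · -- minimality of `k`: `(s,0)` would be joined to `B` through `(k,0)`
    have hsr : ω ∈ openConnIn halfPlane (bpt s) (bpt r) :=
      PlanarDuality.openConnIn_trans (by rw [openConnIn_comm]; exact hks) hkr
    have := hkmin s ⟨hls, by omega, r, hlor, hrhi, hsr⟩
    omega

end NearEndPos

end Summit.CriticalPhenomena.CardyFormulaZ2.Cruxes.HalfPlaneMarkDensityLaw.SketchLine
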